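import Mathlib.Analysis.Normed.Ring.Units
import Literature.Analysis.FluidPDE.HolderEulerTrajectoryContinuation
import Literature.Analysis.Calculus.HadamardGlobalInverse
import HarnessLib

/-!
# Members of Majda–Bertozzi's open set `O_M` are bijections of `ℝ³` (Prop. 4.1 discharged)

Topic `Literature/Analysis/FluidPDE`. Discharge of the named fact
`Literature.Analysis.FluidPDE.MajdaBertozzi2002_trajectoryOpenSet_bijective`
(`HolderEulerTrajectoryContinuation.lean`; Majda–Bertozzi, *Vorticity and Incompressible Flow*,
CUP 2002, §4.1.2 **Prop. 4.1**, p. 127 of the held text: "the set `O_M` … consists of 1-1 mappings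
of `ℝ³` onto `ℝ³`"), by the printed argument (p. 127–128): a member `Y` of
`O_M = {Y ∈ B : inf det ∇Y > 1/2, |Y|_{1,γ} < M}` has `∇Y(α)` invertible with `|(∇_αY)⁻¹(α)|`
bounded uniformly in `α` (there by the cofactor inequality (4.19), `≤ cM^{2N−1}`; here by
compactness of `{A : ‖A‖ ≤ M, det A ≥ c}` in the `3 × 3` matrices and continuity of inversion),
and `∇Y` is `γ`-Hölder, so uniformly continuous for `γ > 0`; **Hadamard's Lemma 4.4** — proved in
the tree as `Literature.Analysis.Calculus.bijective_of_hasFDerivAt_of_norm_inverse_le`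
(`Calculus/HadamardGlobalInverse.lean`) — makes `Y` a bijection (indeed a homeomorphism) of `ℝ³`.

## Contents (all proved)

* `isInvertible_of_det_ne_zero` — a continuous linear endomorphism of a
  finite-dimensional real normed space with nonzero determinant is invertible (dictionary
  `det ≠ 0 → IsUnit → ker = ⊥, range = ⊤ → ContinuousLinearEquiv.ofBijective`);
* `exists_norm_inverse_le_of_det_ge` — on `{‖A‖ ≤ M, c ≤ det A}`, `c > 0`, the inverses are
  uniformly bounded (the rôle of (4.19) in the proof of Prop. 4.1);
* `exists_isInvertible_fderiv_of_mem_trajectoryOpenSet` — the hypotheses of Hadamard's theorem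
  for a member of `O_M`;
* `MajdaBertozzi2002_trajectoryOpenSet_bijective_holds` — **Prop. 4.1 discharged**;
* `exists_homeomorph_of_mem_trajectoryOpenSet` — members of `O_M` are homeomorphisms of `ℝ³`
  (the printed conclusion of Lemma 4.4).

This is leaf 1 of 3 under `MajdaBertozzi2002_particleTrajectoryContinuation_of_lagrangianField`
(the others: Prop. 4.2 `MajdaBertozzi2002_lagrangianField_lipschitzOn` and the volume
preservation `MajdaBertozzi2002_particleTrajectory_volumePreserving`).

## References

* A. J. Majda, A. L. Bertozzi, *Vorticity and Incompressible Flow* (CUP 2002), §4.1.2 Prop. 4.1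
  and Lemma 4.4 (p. 127–128), (4.19) (p. 127). [MajdaBertozziCUP2002]
-/

noncomputable section

open Set Function Filter Metric
open _root_.Topology
open scoped NNReal

namespace Literature.Analysis.FluidPDE

open FunctionSpaces

/-! ### Invertibility from the determinant, and a uniform bound on inverses -/

/-- **Nonzero determinant makes a continuous linear endomorphism invertible** (finite
dimension): `det A ≠ 0` makes `A` a unit of `End(E)` (Mathlib `LinearMap.isUnit_iff_isUnit_det`),
hence injective with full range, and `ContinuousLinearEquiv.ofBijective` bundles the inverse.
[folklore] -/
theorem isInvertible_of_det_ne_zero {E : Type*}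
    [NormedAddCommGroup E] [NormedSpace ℝ E] [FiniteDimensional ℝ E] {A : E →L[ℝ] E}
    (h : A.det ≠ 0) : A.IsInvertible := by
  haveI : CompleteSpace E := FiniteDimensional.complete ℝ E
  have hu : IsUnit (A : E →ₗ[ℝ] E) := by
    rw [LinearMap.isUnit_iff_isUnit_det]
    exact isUnit_iff_ne_zero.2 h
  have hker : LinearMap.ker (A : E →ₗ[ℝ] E) = ⊥ := (LinearMap.isUnit_iff_ker_eq_bot _).1 hu
  have hrange : LinearMap.range (A : E →ₗ[ℝ] E) = ⊤ :=
    (LinearMap.isUnit_iff_range_eq_top _).1 hu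
  exact ⟨ContinuousLinearEquiv.ofBijective A hker hrange,
    ContinuousLinearEquiv.coe_ofBijective _ _ _⟩

/-- **Uniform bound on inverses over `{‖A‖ ≤ M, det A ≥ c}`, `c > 0`** (finite dimension): the
set is compact (closed and bounded), consists of invertible maps, and inversion is continuous at
every invertible map (Mathlib `NormedRing.inverse_continuousAt`), so `‖A⁻¹‖` is bounded on it.
This replaces the cofactor inequality (4.19) of Majda–Bertozzi (`|(∇_αX)⁻¹| ≤ c|X|_{1,γ}^{2N−1}`,
p. 127–128) in the proof of Prop. 4.1, where only the existence of a uniform bound is used. [folklore] -/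
theorem exists_norm_inverse_le_of_det_ge {E : Type*} [NormedAddCommGroup E] [NormedSpace ℝ E]
    [FiniteDimensional ℝ E] (M : ℝ) {c : ℝ} (hc : 0 < c) :
    ∃ K : ℝ, ∀ A : E →L[ℝ] E, ‖A‖ ≤ M → c ≤ A.det → A.IsInvertible ∧ ‖A.inverse‖ ≤ K := by
  set S : Set (E →L[ℝ] E) := {A | ‖A‖ ≤ M ∧ c ≤ A.det} with hS
  have hinv : ∀ A ∈ S, A.IsInvertible := fun A hA =>
    isInvertible_of_det_ne_zero (ne_of_gt (hc.trans_le hA.2))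
  have hSc : IsCompact S := by
    refine Metric.isCompact_of_isClosed_isBounded ?_ ?_
    · exact (isClosed_le continuous_norm continuous_const).inter
        (isClosed_le continuous_const ContinuousLinearMap.continuous_det)
    · exact (Metric.isBounded_closedBall (x := (0 : E →L[ℝ] E)) (r := M)).subset
        fun A hA => mem_closedBall_zero_iff.2 hA.1
  have hcont : ContinuousOn (fun A : E →L[ℝ] E => ‖A.inverse‖) S := by
    refine fun A hA => ContinuousAt.continuousWithinAt ?_
    refine continuous_norm.continuousAt.comp ?_
    obtain ⟨e, he⟩ := hinv A hA
    have h := NormedRing.inverse_continuousAt (ContinuousLinearEquiv.toUnit e)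
    rw [ContinuousLinearMap.ringInverse_eq_inverse] at h
    rw [← he]
    exact h
  obtain ⟨K, hK⟩ := hSc.bddAbove_image hcont
  exact ⟨K, fun A hA hdet => ⟨hinv A ⟨hA, hdet⟩, hK ⟨A, ⟨hA, hdet⟩, rfl⟩⟩⟩

/-! ### Prop. 4.1 discharged -/

variable {γ : ℝ≥0} {M : ℝ}
  {Y : C1HolderMap (EuclideanSpace ℝ (Fin 3)) (EuclideanSpace ℝ (Fin 3)) γ}

/-- **The hypotheses of Hadamard's theorem for a member of `O_M`**: every `∇Y(α)` is invertible
with `‖∇Y(α)⁻¹‖` bounded uniformly in `α` (`exists_norm_inverse_le_of_det_ge` with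
`‖∇Y(α)‖ ≤ |Y|_{1,γ} < M` and `det ∇Y(α) ≥ c > 1/2`; Majda–Bertozzi p. 128:
"`|(∇_αX)⁻¹(α)| ≤ |X⁻¹|_{1,γ} ≤ c|X|_{1,γ}^{2N−1} ≤ cM^{2N−1}`"), and `∇Y` is uniformly
continuous (`γ`-Hölder, `γ > 0`). [cite: MajdaBertozziCUP2002, §4.1.2 proof of Prop. 4.1 (p. 128)] -/
theorem exists_isInvertible_fderiv_of_mem_trajectoryOpenSet (hγ : 0 < γ)
    (hY : Y ∈ trajectoryOpenSet γ M) :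
    (∃ K : ℝ, ∀ α, (fderiv ℝ ⇑Y α).IsInvertible ∧ ‖(fderiv ℝ ⇑Y α).inverse‖ ≤ K) ∧
      UniformContinuous (fderiv ℝ ⇑Y) := by
  obtain ⟨⟨c, hc, hcY⟩, hYM⟩ := hY
  obtain ⟨K, hK⟩ := exists_norm_inverse_le_of_det_ge (E := EuclideanSpace ℝ (Fin 3)) M
    (show (0 : ℝ) < c by linarith)
  refine ⟨⟨K, fun α => hK _ ((Y.norm_fderiv_le α).trans hYM.le) (hcY α)⟩, ?_⟩
  obtain ⟨C, hC⟩ := Y.memBoundedHolder.memHolder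
  exact hC.uniformContinuous hγ

/-- **Majda–Bertozzi Prop. 4.1 (bijectivity clause), proved**: every member of
`O_M = {Y ∈ B : inf det ∇Y > 1/2, |Y|_{1,γ} < M}`, `0 < γ ≤ 1`, is a bijection of `ℝ³`. As
printed (p. 127–128): `∇Y(α)` is invertible with `|(∇_αY)⁻¹(α)|` bounded uniformly in `α`, and
Hadamard's Lemma 4.4 applies
(`Literature.Analysis.Calculus.bijective_of_hasFDerivAt_of_norm_inverse_le`; its
uniform-continuity hypothesis holds because `∇Y` is `γ`-Hölder with `γ > 0`). [cite: MajdaBertozziCUP2002, §4.1.2 Prop. 4.1 with Lemma 4.4 (p. 127–128)] -/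
theorem MajdaBertozzi2002_trajectoryOpenSet_bijective_holds :
    MajdaBertozzi2002_trajectoryOpenSet_bijective := by
  intro γ hγ _ M _ Y hY
  obtain ⟨⟨K, hK⟩, hu⟩ := exists_isInvertible_fderiv_of_mem_trajectoryOpenSet hγ hY
  exact Literature.Analysis.Calculus.bijective_of_hasFDerivAt_of_norm_inverse_le
    (fun α => (Y.differentiable α).hasFDerivAt) (fun α => (hK α).1) (fun α => (hK α).2) hu

/-- **Members of `O_M` are homeomorphisms of `ℝ³` onto `ℝ³`** (the conclusion of Lemma 4.4 as
printed, p. 127: "`X` is a homeomorphism of `ℝ³` onto `ℝ³`"), for `0 < γ`. [cite: MajdaBertozziCUP2002, §4.1.2 Lemma 4.4 and Prop. 4.1 (p. 127–128)] -/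
theorem exists_homeomorph_of_mem_trajectoryOpenSet (hγ : 0 < γ)
    (hY : Y ∈ trajectoryOpenSet γ M) :
    ∃ h : EuclideanSpace ℝ (Fin 3) ≃ₜ EuclideanSpace ℝ (Fin 3), ⇑h = ⇑Y := by
  obtain ⟨⟨K, hK⟩, hu⟩ := exists_isInvertible_fderiv_of_mem_trajectoryOpenSet hγ hY
  exact Literature.Analysis.Calculus.exists_homeomorph_of_hasFDerivAt_of_norm_inverse_le
    (fun α => (Y.differentiable α).hasFDerivAt) (fun α => (hK α).1) (fun α => (hK α).2) hu

/-- **Members of `O_M` are bijections** in the unbundled form consumed by the Lagrangian files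
(`0 < γ ≤ 1`, any `M`; `O_M` is empty unless `M > 0`). [cite: MajdaBertozziCUP2002, §4.1.2 Prop. 4.1 (p. 127)] -/
theorem bijective_of_mem_trajectoryOpenSet (hγ : 0 < γ) (hγ1 : γ ≤ 1)
    (hY : Y ∈ trajectoryOpenSet γ M) : Bijective ⇑Y :=
  MajdaBertozzi2002_trajectoryOpenSet_bijective_holds γ hγ hγ1 M (pos_of_mem_trajectoryOpenSet hY)
    Y hY

end Literature.Analysis.FluidPDE
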